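/-
Copyright (c) 2026 the pub-hodgecm-mathlib formalisation cell (harness21).  Prover seat hodgecm-mathlib-F0P2-p09 (g0), re-dealt to L1
`stub_firstTermThetaPairing` (director s1969∕s1970: «p09 → the p20 file»); hLiu418 = `stmt-HodgeConjecture-24832`; I4-conv (F′-fact) FILE D0, part 1 of 2.
-/
import Literature.NumberTheory.Automorphic.UnitaryGroupTraceZeroLine                   -- ★ `quadraticAdeleEquiv` (via `QuadraticAdeleBaseChange`), `fst_quadraticAdeleEquiv_symm_eq_zero`, `baseChange_mul_algebraMap_mem_traceZeroAdele`
import Literature.NumberTheory.Automorphic.FiniteAdeleFactorizable                      -- ★ `piTranspose`, `integralBox` (+ `isOpen_∕mem_integralBox_iff`)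
import Literature.NumberTheory.Automorphic.AdelicSecondCountable                        -- ★ `countable_heightOneSpectrum`, `secondCountableTopology_{adeleRing, adicCompletion, infiniteAdeleRing}`
import Literature.NumberTheory.Automorphic.AdicCompletionLocalField                     -- ★ `K_v` locally compact (instances)
import Literature.NumberTheory.Automorphic.AdicCompletionCompact                        -- ★ `locallyCompactSpace_adeleRing'`
import Literature.NumberTheory.Automorphic.UnitaryGroupOfFormAdelicTopology             -- ★ `continuous_conjAdele`
import Literature.NumberTheory.GelbartRogawski1991.DoubledUnitaryGlobalSplittingData     -- ★ `Fp L = L⁺`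
import Literature.MeasureTheory.RestrictedProduct.Borel                                 -- ★ `instMeasurableSpace` on `Πʳ`, `borelSpace`, `secondCountableTopology`
import Literature.Topology.Metrizable.LocallyCompactPolish                              -- ★ `polishSpace_of_locallyCompactSpace_of_secondCountableTopology`
import Mathlib.MeasureTheory.Constructions.Polish.Basic
import HarnessLib

/-!
# Crux `HLiu418`, I4-conv (F′-fact), FILE D0 (part 1 of 2) — `K2LiuKlingenFibreCoordinates`: THE KLINGEN FIBRE `Y(𝔸) × 𝔸_L` IN QUADRATIC COORDINATES,
# AS `((Fin 3 → L⁺_∞) × Π_{v∈S} (Fin 3 → L⁺_v)) × Πʳ_{v∉S} [Fin 3 → L⁺_v, 𝒪_v³]` — a continuous additive MEASURABLE EQUIVALENCE with explicit place components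

Cell `hodgecm-mathlib`, crux item hLiu418 = `stmt-HodgeConjecture-24832`; squad K2 ∕ K2Liu (re-dealt hand F0P2-p09 (g0), director s1970); LEAD F0P6-plan (g14); spec
K2Liu-p14 (g3) I4-conv census `K2/K2Liu-p14/g3/CENSUS-I4conv-FprimeFact.K2Liu-p14-g3.md` §2 FILE D0 + TARGET SHAPE 14:47:39Z.  THEOREMS ONLY (no `def`, no instance, no
notation, no named-fact hypothesis, no `sorry`); lane `--supports stmt-HodgeConjecture-24832 --as helper`.  Sequel (part 2): `K2LiuKlingenFibreHaarPinned` (the Haar pin).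

THE OBJECTS.  `Y = {y ∈ 𝔸_L | σ y = −y}` the skew adeles (binder `hY`, exactly ★ F5-e∕F5-k∕F8's); the inner section `F′_h` of term 2 of the Klingen constant term is an
integral over the fibre `Y(𝔸) × 𝔸_L` (★ F5-e∕F5-q∕F8, Haar structure ★ F5-k).  THE COORDINATES (census route α): with `δ ∈ L`, `σ δ = −δ ≠ 0`, and ★
`Ψ := quadraticAdeleEquiv L⁺ L σ : 𝔸_{L⁺} × 𝔸_{L⁺} ≃ₜ+ 𝔸_L`, `(a, b) ↦ a ⊗ 1 + (b ⊗ 1) δ` [CasselsFrohlichANT1967, Ch. II §14], a point `q = (y, t)` of the fibre is the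
triple `(b_y ; a_t, b_t) ∈ 𝔸_{L⁺}³` (`y = Ψ(0, b_y)` because `σ y = −y`, ★ `fst_quadraticAdeleEquiv_symm_eq_zero`; `t = Ψ(a_t, b_t)`), and `𝔸_{L⁺} = L⁺_∞ × Πʳ_v [L⁺_v, 𝒪_v]` IS
Mathlib's restricted product over the finite places `v` of `L⁺` — no regrouping of `𝔸_L` over `L⁺` is needed.  The local carrier at `v` is `L⁺_v³ = Fin 3 → L⁺_v` with
integral box `𝒪_v³` (★ `integralBox`, written as the additive subgroup `Π_i 𝒪_v` so that Mathlib's topological-group structure on the restricted product and ★ D0a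
`K2LiuRestrictedProductAddHaar` apply; `coe_pi_integers_eq_integralBox`).
* §1 (any number field `F`, finite type `ι`, finite set `S` of places): the split transposition `(ι → 𝔸_{F,f}) → (Π_{v∈S} F_v^ι) × Πʳ_{v∉S} [F_v^ι, 𝒪_v^ι]` is continuous
  (`continuous_piTranspose` — Mathlib `RestrictedProduct.continuous_dom_pi`, the argument of ★ `FiniteAdelePureTensorIntegral` —, `continuous_mapAlong_piTranspose`) and
  onto (`exists_piTranspose_eq`: glue, then ★ `piTranspose⁻¹`).
* §2 **`exists_measurableEquiv_coord`** — a MEASURABLE EQUIVALENCE `E : Y(𝔸) × 𝔸_L ≃ᵐ ((Fin 3 → L⁺_∞) × Π_{v∈S} (Fin 3 → L⁺_v)) × Πʳ_{v∉S} [Fin 3 → L⁺_v, 𝒪_v³]`,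
  CONTINUOUS and ADDITIVE, with the coordinate formulas `(E q).1.1 = ![b_{y,∞}, a_{t,∞}, b_{t,∞}]`, `(E q).1.2 v = (E q).2 v = ![b_{y,v}, a_{t,v}, b_{t,v}]`
  (measurability of `E⁻¹`: a continuous injection on the Polish space `Y(𝔸) × 𝔸_L` is a measurable embedding — Mathlib `Continuous.measurableEmbedding`, ★
  `LocallyCompactPolish`).
[CasselsFrohlichANT1967, Ch. II §14; Ch. XV (Tate) §3.3], [BorelJacquet1979, §4.1], [WeilBNT1967, Ch. IV §1–§2].
HONEST LABEL.  Count-neutral helper: `HC_CM` is proved only modulo the 7 printed citations (2 remaining named inputs: hLiu418 = `stmt-HodgeConjecture-24832`,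
h413 = `stmt-HodgeConjecture-24833`) until rung 0 closes; this file closes no socket by itself.

## Mathlib ∕ tree search
Tree ★: `quadraticAdeleEquiv{,_apply}`, `fst_quadraticAdeleEquiv_symm_eq_zero`, `baseChange_mul_algebraMap_mem_traceZeroAdele`, `piTranspose{,_symm_apply}`, `integralBox`,
`mem_integralBox_iff`, `isOpen_integralBox`, `AdelicSecondCountable.*`, `locallyCompactSpace_adeleRing'`, `continuous_conjAdele`, `RestrictedProduct.Borel.{borelSpace,
secondCountableTopology}`, `polishSpace_of_locallyCompactSpace_of_secondCountableTopology`.  Mathlib: `RestrictedProduct.{continuous_dom_pi, continuous_rng_of_principal,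
continuous_inclusion, continuous_eval, mapAlong, mapAlong_continuous}`, `Continuous.matrixVecCons`, `Continuous.measurableEmbedding`, `Equiv.image_eq_preimage_symm`.
Dedup: `rg "KlingenFibre|piTranspose.*mapAlong" Summits/` — none; road not taken (census β): the fibre as the abelian subgroup `{Ψ(n_Q(y,0,t))} ≤ H(𝔸)` split like ★ Φ3b.

## References
* [CasselsFrohlichANT1967] J. W. S. Cassels, A. Fröhlich (eds.), *Algebraic Number Theory* (1967), Ch. II (Cassels) §14; Ch. XV (Tate) §3.3.
* [BorelJacquet1979] A. Borel, H. Jacquet, *Automorphic forms and automorphic representations*, PSPM 33.1 (1979), §4.1.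
* [WeilBNT1967] A. Weil, *Basic Number Theory* (1967), Ch. IV §1–§2.
-/

set_option autoImplicit false
set_option linter.dupNamespace false -- the mandated namespace repeats `HodgeConjecture.HodgeConjecture`

noncomputable section

open scoped RestrictedProduct ENNReal NNReal Topology
open NumberField IsDedekindDomain MeasureTheory Measure Filter Set

namespace Summit.HodgeConjecture.HodgeConjecture.Cruxes.HLiu418.K2LiuKlingenFibreCoordinates

open Literature.NumberTheory.Automorphic Literature.NumberTheory.Automorphic.UnitaryGroup
open Literature.NumberTheory.GelbartRogawski1991.GRConstruction (Fp)
open Literature.MeasureTheory.RestrictedProduct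

/-! ## §1 `(ι → 𝔸_{F,f}) → (Π_{v∈S} F_v^ι) × Πʳ_{v∉S} [F_v^ι, 𝒪_v^ι]`: the transposition split at a finite set of places -/

section Split

variable (F : Type) [Field F] [NumberField F] (ι : Type) [Finite ι] (S : Finset (HeightOneSpectrum (𝓞 F)))

omit [Finite ι] in
/-- the integral box `𝒪_v^ι` as an additive subgroup `Π_{i} 𝒪_v` has the tree's `integralBox F ι v` as underlying set. [folklore] -/
theorem coe_pi_integers_eq_integralBox (v : HeightOneSpectrum (𝓞 F)) :
    ((AddSubgroup.pi Set.univ (fun _ : ι => (v.adicCompletionIntegers F).toSubring.toAddSubgroup) :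
        AddSubgroup (ι → v.adicCompletion F)) : Set (ι → v.adicCompletion F)) = integralBox F ι v := by
  ext z
  simp only [SetLike.mem_coe, AddSubgroup.mem_pi, Set.mem_univ, forall_const, mem_integralBox_iff]
  rfl

omit [Finite ι] in
/-- `𝒪_v^ι ⊆ Π_i 𝒪_v` as a `MapsTo` statement for the identity (the compatibility ★ `mapAlong` wants). [folklore] -/
theorem mapsTo_id_integralBox (v : HeightOneSpectrum (𝓞 F)) :
    MapsTo id (integralBox F ι v)
      ((AddSubgroup.pi Set.univ (fun _ : ι => (v.adicCompletionIntegers F).toSubring.toAddSubgroup) :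
        AddSubgroup (ι → v.adicCompletion F)) : Set (ι → v.adicCompletion F)) := by
  rw [coe_pi_integers_eq_integralBox]
  exact mapsTo_id _

/-- **the transposition `(x_i)_i ↦ (((x_i)_v)_i)_v` is continuous** `(ι → 𝔸_{F,f}) → Πʳ_v [F_v^ι, 𝒪_v^ι]` (finitary universal property of the restricted
product, Mathlib `RestrictedProduct.continuous_dom_pi`; the argument of ★ `FiniteAdelePureTensorIntegral`). [cite: CasselsFrohlichANT1967, Ch. II §14] -/
theorem continuous_piTranspose : Continuous (piTranspose F ι) := by
  have hO : ∀ (_ : ι) (v : HeightOneSpectrum (𝓞 F)), IsOpen ((v.adicCompletionIntegers F : Set (v.adicCompletion F))) :=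
    fun _ v => Valued.isOpen_valuationSubring _
  refine (RestrictedProduct.continuous_dom_pi hO).mpr fun T hT => ?_
  let g : (ι → Πʳ v : HeightOneSpectrum (𝓞 F), [v.adicCompletion F, (v.adicCompletionIntegers F : Set (v.adicCompletion F))]_[𝓟 T]) →
      Πʳ v : HeightOneSpectrum (𝓞 F), [ι → v.adicCompletion F, integralBox F ι v]_[𝓟 T] :=
    fun x => ⟨fun v i => x i v, (eventually_all.mpr fun i => (x i).2).mono fun v hv => mem_integralBox_iff.mpr hv⟩
  have hg : Continuous g :=
    RestrictedProduct.continuous_rng_of_principal.mpr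
      (continuous_pi fun v => continuous_pi fun i => (RestrictedProduct.continuous_eval v).comp (continuous_apply i))
  exact Continuous.congr ((RestrictedProduct.continuous_inclusion hT).comp hg) fun _ => rfl

/-- the coordinates off `S` of the transposition: `x ↦ (((x_i)_v)_i)_{v∉S}`, continuous into `Πʳ_{v∉S} [F_v^ι, Π_i 𝒪_v]` (Mathlib `mapAlong` along `Subtype.val`).
[cite: CasselsFrohlichANT1967, Ch. II §14] -/
theorem continuous_mapAlong_piTranspose :
    Continuous (fun x : ι → FiniteAdeleRing (𝓞 F) F =>
      RestrictedProduct.mapAlong (fun v : HeightOneSpectrum (𝓞 F) => ι → v.adicCompletion F)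
        (fun v : {v : HeightOneSpectrum (𝓞 F) // v ∉ S} => ι → v.1.adicCompletion F)
        Subtype.val Subtype.val_injective.tendsto_cofinite (fun _ => id) (Eventually.of_forall fun v => mapsTo_id_integralBox F ι v.1)
        (piTranspose F ι x) :
      (ι → FiniteAdeleRing (𝓞 F) F) → Πʳ v : {v : HeightOneSpectrum (𝓞 F) // v ∉ S},
        [ι → v.1.adicCompletion F, (AddSubgroup.pi Set.univ (fun _ : ι => (v.1.adicCompletionIntegers F).toSubring.toAddSubgroup) :
          AddSubgroup (ι → v.1.adicCompletion F))]) :=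
  (RestrictedProduct.mapAlong_continuous _ _ _ _ _ _ fun _ => continuous_id).comp (continuous_piTranspose F ι)

/-- **surjectivity of the split transposition**: every pair `((p_v)_{v∈S}, (r_v)_{v∉S})` of local tuples, integral for almost all `v ∉ S`, is the family of
place components of a (unique) tuple of finite adeles (glue, then ★ `piTranspose⁻¹`). [cite: CasselsFrohlichANT1967, Ch. II §14] -/
theorem exists_piTranspose_eq [DecidableEq (HeightOneSpectrum (𝓞 F))] (p : Π v : S, ι → v.1.adicCompletion F)
    (r : Πʳ v : {v : HeightOneSpectrum (𝓞 F) // v ∉ S},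
        [ι → v.1.adicCompletion F, (AddSubgroup.pi Set.univ (fun _ : ι => (v.1.adicCompletionIntegers F).toSubring.toAddSubgroup) :
          AddSubgroup (ι → v.1.adicCompletion F))]) :
    ∃ x : ι → FiniteAdeleRing (𝓞 F) F, (∀ v : S, (fun i => x i v.1) = p v) ∧
      ∀ v : {v : HeightOneSpectrum (𝓞 F) // v ∉ S}, (fun i => x i v.1) = r v := by
  -- the glued restricted family over all places
  let g : Π v : HeightOneSpectrum (𝓞 F), ι → v.adicCompletion F := fun v => if h : v ∈ S then p ⟨v, h⟩ else r ⟨v, h⟩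
  have hgS : ∀ v (h : v ∈ S), g v = p ⟨v, h⟩ := fun v h => by
    show (if h : v ∈ S then p ⟨v, h⟩ else r ⟨v, h⟩) = p ⟨v, h⟩
    rw [dif_pos h]
  have hgS' : ∀ v (h : v ∉ S), g v = r ⟨v, h⟩ := fun v h => by
    show (if h : v ∈ S then p ⟨v, h⟩ else r ⟨v, h⟩) = r ⟨v, h⟩
    rw [dif_neg h]
  have hev : ∀ᶠ v : HeightOneSpectrum (𝓞 F) in cofinite, g v ∈ integralBox F ι v := by
    have hr : {w : {v : HeightOneSpectrum (𝓞 F) // v ∉ S} | ¬ r w ∈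
        ((AddSubgroup.pi Set.univ (fun _ : ι => (w.1.adicCompletionIntegers F).toSubring.toAddSubgroup) :
          AddSubgroup (ι → w.1.adicCompletion F)) : Set (ι → w.1.adicCompletion F))}.Finite :=
      Filter.eventually_cofinite.1 r.2
    refine Filter.eventually_cofinite.2 (((S.finite_toSet).union (hr.image Subtype.val)).subset fun v hv => ?_)
    by_cases h : v ∈ S
    · exact Or.inl h
    · refine Or.inr ⟨⟨v, h⟩, ?_, rfl⟩
      intro hmem
      apply hv
      show g v ∈ integralBox F ι v
      rw [hgS' v h, ← coe_pi_integers_eq_integralBox]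
      exact hmem
  refine ⟨(piTranspose F ι).symm ⟨g, hev⟩, fun v => ?_, fun v => ?_⟩
  · funext i
    rw [piTranspose_symm_apply]
    show g v.1 i = p v i
    rw [hgS v.1 v.2]
  · funext i
    rw [piTranspose_symm_apply]
    show g v.1 i = r v i
    rw [hgS' v.1 v.2]

end Split

/-! ## §2 The quadratic coordinates of the Klingen fibre: `Y(𝔸) × 𝔸_L ≃ (L⁺_∞³ × Π_{v∈S} L⁺_v³) × Πʳ_{v∉S} [L⁺_v³, 𝒪_v³]` -/

section Coordinates

variable (L : Type) [Field L] [NumberField L] [IsCMField L]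

/-- **THE KLINGEN FIBRE IN QUADRATIC COORDINATES, SPLIT AT `S`.**  For `Y = {y ∈ 𝔸_L | σ y = −y}` (binder `hY`, ★ F5-k's) and `δ ∈ L` with `σ δ = −δ ≠ 0`, read
`q = (y, t) ∈ Y(𝔸) × 𝔸_L` through ★ `Ψ := quadraticAdeleEquiv L⁺ L σ : 𝔸_{L⁺} × 𝔸_{L⁺} ≃ₜ+ 𝔸_L` as the triple `(b_y ; a_t, b_t) ∈ 𝔸_{L⁺}³` (`y = Ψ(0, b_y)` since
`σ y = −y`, ★ `fst_quadraticAdeleEquiv_symm_eq_zero`; `t = Ψ(a_t, b_t)`).  THEN there is a MEASURABLE EQUIVALENCE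
`E : Y(𝔸) × 𝔸_L ≃ᵐ ((Fin 3 → L⁺_∞) × Π_{v∈S} (Fin 3 → L⁺_v)) × Πʳ_{v∉S} [Fin 3 → L⁺_v, 𝒪_v³]`, CONTINUOUS and ADDITIVE, whose coordinates are the place
components of that triple: `(E q).1.1 = ![b_{y,∞}, a_{t,∞}, b_{t,∞}]`, `(E q).1.2 v = (E q).2 v = ![b_{y,v}, a_{t,v}, b_{t,v}]` (continuity: Mathlib
`RestrictedProduct.continuous_dom_pi` ∕ `mapAlong_continuous`; bijectivity: §1 `exists_piTranspose_eq`; measurability of `E⁻¹`: a continuous injection on the Polish space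
`Y(𝔸) × 𝔸_L` is a measurable embedding, Mathlib `Continuous.measurableEmbedding` + ★ `polishSpace_of_locallyCompactSpace_of_secondCountableTopology`).
[cite: CasselsFrohlichANT1967, Ch. II §14] [cite: BorelJacquet1979, §4.1] -/
theorem exists_measurableEquiv_coord
    [MeasurableSpace (AdeleRing (𝓞 L) L)] [BorelSpace (AdeleRing (𝓞 L) L)]
    [MeasurableSpace (InfiniteAdeleRing (Fp L))] [BorelSpace (InfiniteAdeleRing (Fp L))]
    [∀ v : HeightOneSpectrum (𝓞 (Fp L)), MeasurableSpace (v.adicCompletion (Fp L))] [∀ v : HeightOneSpectrum (𝓞 (Fp L)), BorelSpace (v.adicCompletion (Fp L))]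
    {δ : L} (hσδ : IsCMField.complexConj L δ = -δ) (hδ : δ ≠ 0)
    (Y : AddSubgroup (AdeleRing (𝓞 L) L)) (hY : ∀ y, y ∈ Y ↔ conjAdele (Fp L) L (IsCMField.complexConj L) y = -y)
    (S : Finset (HeightOneSpectrum (𝓞 (Fp L)))) :
    ∃ E : (↥Y × AdeleRing (𝓞 L) L) ≃ᵐ
        ((Fin 3 → InfiniteAdeleRing (Fp L)) × (Π v : S, Fin 3 → v.1.adicCompletion (Fp L))) ×
        (Πʳ v : {v : HeightOneSpectrum (𝓞 (Fp L)) // v ∉ S},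
          [Fin 3 → v.1.adicCompletion (Fp L), (AddSubgroup.pi Set.univ (fun _ : Fin 3 => (v.1.adicCompletionIntegers (Fp L)).toSubring.toAddSubgroup) :
            AddSubgroup (Fin 3 → v.1.adicCompletion (Fp L)))]),
      Continuous E ∧ (∀ q q', E (q + q') = E q + E q') ∧
      (∀ q, (E q).1.1 = ![((quadraticAdeleEquiv (Fp L) L (IsCMField.complexConj L) hσδ hδ).symm (q.1 : AdeleRing (𝓞 L) L)).2.1,
        ((quadraticAdeleEquiv (Fp L) L (IsCMField.complexConj L) hσδ hδ).symm q.2).1.1,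
        ((quadraticAdeleEquiv (Fp L) L (IsCMField.complexConj L) hσδ hδ).symm q.2).2.1]) ∧
      (∀ q (v : S), (E q).1.2 v = ![((quadraticAdeleEquiv (Fp L) L (IsCMField.complexConj L) hσδ hδ).symm (q.1 : AdeleRing (𝓞 L) L)).2.2 v.1,
        ((quadraticAdeleEquiv (Fp L) L (IsCMField.complexConj L) hσδ hδ).symm q.2).1.2 v.1,
        ((quadraticAdeleEquiv (Fp L) L (IsCMField.complexConj L) hσδ hδ).symm q.2).2.2 v.1]) ∧
      (∀ q (v : {v : HeightOneSpectrum (𝓞 (Fp L)) // v ∉ S}), (E q).2 v =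
        ![((quadraticAdeleEquiv (Fp L) L (IsCMField.complexConj L) hσδ hδ).symm (q.1 : AdeleRing (𝓞 L) L)).2.2 v.1,
          ((quadraticAdeleEquiv (Fp L) L (IsCMField.complexConj L) hσδ hδ).symm q.2).1.2 v.1,
          ((quadraticAdeleEquiv (Fp L) L (IsCMField.complexConj L) hσδ hδ).symm q.2).2.2 v.1]) := by
  classical
  -- point-set instances
  haveI : Countable (HeightOneSpectrum (𝓞 (Fp L))) := countable_heightOneSpectrum (Fp L)
  haveI : ∀ v : HeightOneSpectrum (𝓞 (Fp L)), SecondCountableTopology (v.adicCompletion (Fp L)) :=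
    fun v => secondCountableTopology_adicCompletion (Fp L) v
  haveI : SecondCountableTopology (InfiniteAdeleRing (Fp L)) := secondCountableTopology_infiniteAdeleRing (Fp L)
  haveI : SecondCountableTopology (AdeleRing (𝓞 L) L) := secondCountableTopology_adeleRing L
  haveI : LocallyCompactSpace (AdeleRing (𝓞 L) L) := locallyCompactSpace_adeleRing' L
  haveI : T2Space (InfiniteAdeleRing L) := inferInstanceAs (T2Space ((w : InfinitePlace L) → w.Completion))
  haveI : T2Space (FiniteAdeleRing (𝓞 L) L) :=
    inferInstanceAs (T2Space (RestrictedProduct (fun w : HeightOneSpectrum (𝓞 L) => w.adicCompletion L)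
      (fun w => (w.adicCompletionIntegers L : Set (w.adicCompletion L))) Filter.cofinite))
  haveI : T2Space (AdeleRing (𝓞 L) L) := inferInstanceAs (T2Space (InfiniteAdeleRing L × FiniteAdeleRing (𝓞 L) L))
  have hYc : IsClosed (Y : Set (AdeleRing (𝓞 L) L)) := by
    have h : (Y : Set (AdeleRing (𝓞 L) L)) = {y | conjAdele (Fp L) L (IsCMField.complexConj L) y = -y} := Set.ext fun y => hY y
    rw [h]
    exact isClosed_eq (continuous_conjAdele (Fp L) L (IsCMField.complexConj L)) continuous_neg
  haveI : LocallyCompactSpace ↥Y := hYc.isClosedEmbedding_subtypeVal.locallyCompactSpace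
  haveI : SecondCountableTopology ↥Y := TopologicalSpace.Subtype.secondCountableTopology _
  haveI : PolishSpace (↥Y × AdeleRing (𝓞 L) L) :=
    Literature.Topology.Metrizable.polishSpace_of_locallyCompactSpace_of_secondCountableTopology _
  haveI : BorelSpace (↥Y × AdeleRing (𝓞 L) L) := Prod.borelSpace
  haveI hKo : Fact (∀ v : {v : HeightOneSpectrum (𝓞 (Fp L)) // v ∉ S},
      IsOpen ((AddSubgroup.pi Set.univ (fun _ : Fin 3 => (v.1.adicCompletionIntegers (Fp L)).toSubring.toAddSubgroup) :
        AddSubgroup (Fin 3 → v.1.adicCompletion (Fp L))) : Set (Fin 3 → v.1.adicCompletion (Fp L)))) :=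
    ⟨fun v => by rw [coe_pi_integers_eq_integralBox]; exact isOpen_integralBox (Fp L) (Fin 3) v.1⟩
  haveI : BorelSpace (Πʳ v : {v : HeightOneSpectrum (𝓞 (Fp L)) // v ∉ S},
      [Fin 3 → v.1.adicCompletion (Fp L), (AddSubgroup.pi Set.univ (fun _ : Fin 3 => (v.1.adicCompletionIntegers (Fp L)).toSubring.toAddSubgroup) :
        AddSubgroup (Fin 3 → v.1.adicCompletion (Fp L)))]) :=
    borelSpace (fun v : {v : HeightOneSpectrum (𝓞 (Fp L)) // v ∉ S} =>
      ((AddSubgroup.pi Set.univ (fun _ : Fin 3 => (v.1.adicCompletionIntegers (Fp L)).toSubring.toAddSubgroup) :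
        AddSubgroup (Fin 3 → v.1.adicCompletion (Fp L))) : Set (Fin 3 → v.1.adicCompletion (Fp L)))) (fun v => (hKo.out v).measurableSet)
  haveI : SecondCountableTopology (Πʳ v : {v : HeightOneSpectrum (𝓞 (Fp L)) // v ∉ S},
      [Fin 3 → v.1.adicCompletion (Fp L), (AddSubgroup.pi Set.univ (fun _ : Fin 3 => (v.1.adicCompletionIntegers (Fp L)).toSubring.toAddSubgroup) :
        AddSubgroup (Fin 3 → v.1.adicCompletion (Fp L)))]) :=
    secondCountableTopology (fun v : {v : HeightOneSpectrum (𝓞 (Fp L)) // v ∉ S} =>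
      ((AddSubgroup.pi Set.univ (fun _ : Fin 3 => (v.1.adicCompletionIntegers (Fp L)).toSubring.toAddSubgroup) :
        AddSubgroup (Fin 3 → v.1.adicCompletion (Fp L))) : Set (Fin 3 → v.1.adicCompletion (Fp L)))) hKo.out
  -- the quadratic coordinates
  set Ψ := quadraticAdeleEquiv (Fp L) L (IsCMField.complexConj L) hσδ hδ with hΨ
  have hY0 : ∀ y : ↥Y, (Ψ.symm (y : AdeleRing (𝓞 L) L)).1 = 0 := fun y =>
    fst_quadraticAdeleEquiv_symm_eq_zero L (IsCMField.complexConj L) hσδ hδ ⟨(y : AdeleRing (𝓞 L) L), (hY _).1 y.2⟩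
  have hYmem : ∀ b : AdeleRing (𝓞 (Fp L)) (Fp L), Ψ (0, b) ∈ Y := fun b => by
    refine (hY _).2 ?_
    have h : Ψ (0, b) = AdeleRing.baseChange (Fp L) L b * algebraMap L (AdeleRing (𝓞 L) L) δ := by
      rw [hΨ, quadraticAdeleEquiv_apply, map_zero, zero_add]
    rw [h]
    exact baseChange_mul_algebraMap_mem_traceZeroAdele L (IsCMField.complexConj L) hσδ b
  -- `crd q = (b_y ; a_t, b_t)` (opaque local function with its defining equation, to keep unification cheap)
  obtain ⟨crd, hcrd_def⟩ : ∃ crd : (↥Y × AdeleRing (𝓞 L) L) → Fin 3 → AdeleRing (𝓞 (Fp L)) (Fp L),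
      ∀ q, crd q = ![(Ψ.symm (q.1 : AdeleRing (𝓞 L) L)).2, (Ψ.symm q.2).1, (Ψ.symm q.2).2] := ⟨_, fun q => rfl⟩
  have hcrd0 : ∀ q, crd q 0 = (Ψ.symm (q.1 : AdeleRing (𝓞 L) L)).2 := fun q => by rw [hcrd_def]; rfl
  have hcrd1 : ∀ q, crd q 1 = (Ψ.symm q.2).1 := fun q => by rw [hcrd_def]; rfl
  have hcrd2 : ∀ q, crd q 2 = (Ψ.symm q.2).2 := fun q => by rw [hcrd_def]; rfl
  obtain ⟨dcr, hdcr_def⟩ : ∃ dcr : (Fin 3 → AdeleRing (𝓞 (Fp L)) (Fp L)) → (↥Y × AdeleRing (𝓞 L) L),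
      ∀ d, dcr d = (⟨Ψ (0, d 0), hYmem (d 0)⟩, Ψ (d 1, d 2)) := ⟨_, fun d => rfl⟩
  have hcrd_dcr : ∀ d, crd (dcr d) = d := fun d => by
    funext i
    fin_cases i
    · show crd (dcr d) 0 = d 0
      rw [hcrd0, hdcr_def]; show (Ψ.symm (Ψ (0, d 0))).2 = d 0; rw [ContinuousAddEquiv.symm_apply_apply]
    · show crd (dcr d) 1 = d 1
      rw [hcrd1, hdcr_def]; show (Ψ.symm (Ψ (d 1, d 2))).1 = d 1; rw [ContinuousAddEquiv.symm_apply_apply]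
    · show crd (dcr d) 2 = d 2
      rw [hcrd2, hdcr_def]; show (Ψ.symm (Ψ (d 1, d 2))).2 = d 2; rw [ContinuousAddEquiv.symm_apply_apply]
  have hdcr_crd : ∀ q, dcr (crd q) = q := fun q => by
    rw [hdcr_def]
    refine Prod.ext (Subtype.ext ?_) ?_
    · show Ψ (0, crd q 0) = (q.1 : AdeleRing (𝓞 L) L)
      rw [hcrd0]
      conv_rhs => rw [← Ψ.apply_symm_apply (q.1 : AdeleRing (𝓞 L) L)]
      rw [← hY0 q.1]
    · show Ψ (crd q 1, crd q 2) = q.2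
      rw [hcrd1, hcrd2, Prod.mk.eta, ContinuousAddEquiv.apply_symm_apply]
  have hcrd_cont : Continuous crd := by
    have h1 : Continuous fun q : ↥Y × AdeleRing (𝓞 L) L => Ψ.symm (q.1 : AdeleRing (𝓞 L) L) :=
      Ψ.symm.continuous.comp (continuous_subtype_val.comp continuous_fst)
    have h2 : Continuous fun q : ↥Y × AdeleRing (𝓞 L) L => Ψ.symm q.2 := Ψ.symm.continuous.comp continuous_snd
    have h : crd = fun q => ![(Ψ.symm (q.1 : AdeleRing (𝓞 L) L)).2, (Ψ.symm q.2).1, (Ψ.symm q.2).2] := funext hcrd_def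
    rw [h]
    exact (continuous_snd.comp h1).matrixVecCons ((continuous_fst.comp h2).matrixVecCons ((continuous_snd.comp h2).matrixVecCons continuous_const))
  have hcrd_add : ∀ q q', crd (q + q') = crd q + crd q' := fun q q' => by
    funext i
    rw [Pi.add_apply]
    fin_cases i
    · show crd (q + q') 0 = crd q 0 + crd q' 0
      rw [hcrd0, hcrd0, hcrd0]; show (Ψ.symm ((q.1 : AdeleRing (𝓞 L) L) + (q'.1 : AdeleRing (𝓞 L) L))).2 = _; rw [map_add, Prod.snd_add]
    · show crd (q + q') 1 = crd q 1 + crd q' 1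
      rw [hcrd1, hcrd1, hcrd1]; show (Ψ.symm (q.2 + q'.2)).1 = _; rw [map_add, Prod.fst_add]
    · show crd (q + q') 2 = crd q 2 + crd q' 2
      rw [hcrd2, hcrd2, hcrd2]; show (Ψ.symm (q.2 + q'.2)).2 = _; rw [map_add, Prod.snd_add]
  -- the split transposition of the finite parts and the full coordinate map `e` (again opaque)
  obtain ⟨spl, hspl_def⟩ : ∃ spl : (Fin 3 → FiniteAdeleRing (𝓞 (Fp L)) (Fp L)) → Πʳ v : {v : HeightOneSpectrum (𝓞 (Fp L)) // v ∉ S},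
      [Fin 3 → v.1.adicCompletion (Fp L), (AddSubgroup.pi Set.univ (fun _ : Fin 3 => (v.1.adicCompletionIntegers (Fp L)).toSubring.toAddSubgroup) :
        AddSubgroup (Fin 3 → v.1.adicCompletion (Fp L)))],
      spl = fun x => RestrictedProduct.mapAlong (fun v : HeightOneSpectrum (𝓞 (Fp L)) => Fin 3 → v.adicCompletion (Fp L))
        (fun v : {v : HeightOneSpectrum (𝓞 (Fp L)) // v ∉ S} => Fin 3 → v.1.adicCompletion (Fp L))
        Subtype.val Subtype.val_injective.tendsto_cofinite (fun _ => id) (Eventually.of_forall fun v => mapsTo_id_integralBox (Fp L) (Fin 3) v.1)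
        (piTranspose (Fp L) (Fin 3) x) := ⟨_, rfl⟩
  have hspl_apply : ∀ x (v : {v : HeightOneSpectrum (𝓞 (Fp L)) // v ∉ S}), spl x v = fun i => x i v.1 := fun x v => by rw [hspl_def]; rfl
  have hspl_cont : Continuous spl := by rw [hspl_def]; exact continuous_mapAlong_piTranspose (Fp L) (Fin 3) S
  obtain ⟨e, he_def⟩ : ∃ e : (↥Y × AdeleRing (𝓞 L) L) →
      ((Fin 3 → InfiniteAdeleRing (Fp L)) × (Π v : S, Fin 3 → v.1.adicCompletion (Fp L))) ×
        (Πʳ v : {v : HeightOneSpectrum (𝓞 (Fp L)) // v ∉ S},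
          [Fin 3 → v.1.adicCompletion (Fp L), (AddSubgroup.pi Set.univ (fun _ : Fin 3 => (v.1.adicCompletionIntegers (Fp L)).toSubring.toAddSubgroup) :
            AddSubgroup (Fin 3 → v.1.adicCompletion (Fp L)))]),
      ∀ q, e q = ((fun i => (crd q i).1, fun (v : S) (i : Fin 3) => (crd q i).2 v.1), spl (fun i => (crd q i).2)) := ⟨_, fun q => rfl⟩
  have he1 : ∀ q i, (e q).1.1 i = (crd q i).1 := fun q i => by rw [he_def]
  have he2 : ∀ q (v : S) i, (e q).1.2 v i = (crd q i).2 v.1 := fun q v i => by rw [he_def]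
  have he3 : ∀ q (v : {v : HeightOneSpectrum (𝓞 (Fp L)) // v ∉ S}) i, (e q).2 v i = (crd q i).2 v.1 := fun q v i => by
    rw [he_def]
    show spl (fun i => (crd q i).2) v i = _
    rw [hspl_apply]
  have he_cont : Continuous e := by
    have h : e = fun q => ((fun i => (crd q i).1, fun (v : S) (i : Fin 3) => (crd q i).2 v.1), spl (fun i => (crd q i).2)) := funext he_def
    rw [h]
    have hfin : Continuous fun q : ↥Y × AdeleRing (𝓞 L) L => fun i => (crd q i).2 :=
      continuous_pi fun i => continuous_snd.comp ((continuous_apply i).comp hcrd_cont)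
    refine ((continuous_pi fun i => continuous_fst.comp ((continuous_apply i).comp hcrd_cont)).prodMk
      (continuous_pi fun v => continuous_pi fun i => ?_)).prodMk (hspl_cont.comp hfin)
    exact (RestrictedProduct.continuous_eval v.1).comp ((continuous_apply i).comp hfin)
  have he_add : ∀ q q', e (q + q') = e q + e q' := fun q q' => by
    refine Prod.ext (Prod.ext ?_ ?_) ?_
    · funext i
      rw [Prod.fst_add, Prod.fst_add, Pi.add_apply, he1, he1, he1, hcrd_add]
      rfl
    · funext v i
      rw [Prod.fst_add, Prod.snd_add, Pi.add_apply, Pi.add_apply, he2, he2, he2, hcrd_add]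
      rfl
    · refine RestrictedProduct.ext _ _ fun v => funext fun i => ?_
      rw [Prod.snd_add, RestrictedProduct.add_apply, Pi.add_apply, he3, he3, he3, hcrd_add]
      rfl
  have he_inj : Function.Injective e := by
    intro q q' h
    have hcrd : crd q = crd q' := by
      funext i
      refine Prod.ext ?_ (RestrictedProduct.ext _ _ fun v => ?_)
      · rw [← he1, ← he1, h]
      · by_cases hv : v ∈ S
        · have e1 := he2 q ⟨v, hv⟩ i
          have e2 := he2 q' ⟨v, hv⟩ i
          rw [h] at e1
          exact e1.symm.trans e2
        · have e1 := he3 q ⟨v, hv⟩ i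
          have e2 := he3 q' ⟨v, hv⟩ i
          rw [h] at e1
          exact e1.symm.trans e2
    rw [← hdcr_crd q, ← hdcr_crd q', hcrd]
  have he_surj : Function.Surjective e := by
    rintro ⟨⟨dinf, p⟩, r⟩
    obtain ⟨x, hxS, hxS'⟩ := exists_piTranspose_eq (Fp L) (Fin 3) S p r
    obtain ⟨d, hd1, hd2⟩ : ∃ d : Fin 3 → AdeleRing (𝓞 (Fp L)) (Fp L), (∀ i, (d i).1 = dinf i) ∧ ∀ i, (d i).2 = x i :=
      ⟨fun i => (dinf i, x i), fun i => rfl, fun i => rfl⟩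
    refine ⟨dcr d, ?_⟩
    have hc : crd (dcr d) = d := hcrd_dcr d
    refine Prod.ext (Prod.ext ?_ ?_) ?_
    · funext i; rw [he1, hc, hd1]
    · funext v i
      rw [he2, hc, hd2]; exact congrFun (hxS v) i
    · refine RestrictedProduct.ext _ _ fun v => funext fun i => ?_
      rw [he3, hc, hd2]; exact congrFun (hxS' v) i
  -- the measurable equivalence
  have hemb : MeasurableEmbedding e := he_cont.measurableEmbedding he_inj
  let E : (↥Y × AdeleRing (𝓞 L) L) ≃ᵐ
      ((Fin 3 → InfiniteAdeleRing (Fp L)) × (Π v : S, Fin 3 → v.1.adicCompletion (Fp L))) ×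
        (Πʳ v : {v : HeightOneSpectrum (𝓞 (Fp L)) // v ∉ S},
          [Fin 3 → v.1.adicCompletion (Fp L), (AddSubgroup.pi Set.univ (fun _ : Fin 3 => (v.1.adicCompletionIntegers (Fp L)).toSubring.toAddSubgroup) :
            AddSubgroup (Fin 3 → v.1.adicCompletion (Fp L)))]) :=
    { toEquiv := Equiv.ofBijective e ⟨he_inj, he_surj⟩
      measurable_toFun := hemb.measurable
      measurable_invFun := fun s hs => by
        rw [← Equiv.image_eq_preimage_symm]
        exact hemb.measurableSet_image.mpr hs }
  have hEe : ∀ q, E q = e q := fun q => rfl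
  refine ⟨E, (show Continuous e from he_cont), fun q q' => (show e (q + q') = e q + e q' from he_add q q'),
    fun q => ?_, fun q v => ?_, fun q v => ?_⟩
  · funext i
    rw [hEe, he1]
    fin_cases i
    · show (crd q 0).1 = _; rw [hcrd0]; rfl
    · show (crd q 1).1 = _; rw [hcrd1]; rfl
    · show (crd q 2).1 = _; rw [hcrd2]; rfl
  · funext i
    rw [hEe, he2]
    fin_cases i
    · show (crd q 0).2 v.1 = _; rw [hcrd0]; rfl
    · show (crd q 1).2 v.1 = _; rw [hcrd1]; rfl
    · show (crd q 2).2 v.1 = _; rw [hcrd2]; rfl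
  · funext i
    rw [hEe, he3]
    fin_cases i
    · show (crd q 0).2 v.1 = _; rw [hcrd0]; rfl
    · show (crd q 1).2 v.1 = _; rw [hcrd1]; rfl
    · show (crd q 2).2 v.1 = _; rw [hcrd2]; rfl

end Coordinates

end Summit.HodgeConjecture.HodgeConjecture.Cruxes.HLiu418.K2LiuKlingenFibreCoordinates

end
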